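/-
Copyright (c) 2026 the pub-hodgecm-mathlib formalisation cell (harness21).  Prover seat hodgecm-mathlib-F0P3a-p08 (g25): LH4-plan (g6) WORD #92 (P3f)(1)
«SOCKET TRACE TWIN» (CENSUS-M1 bf2b9cff8e6aee20 §3 rows #7 + #13; (P3f) census `F0/P3a/F0P3a-p08/g25/p3f/CENSUS-P3f-socket-gside.v1.F0P3ap08g25.md`); 2026-09-02.
-/
import Literature.NumberTheory.Rogawski1990.DepthZeroKappaTransferTypeOneSocket                   -- ★ the originals: adapter `…_of_split_of_values'` (row #7), socket (row #13), HEAD 1, O8d-alg, exponent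
import Literature.NumberTheory.Rogawski1990.FlickerTraceFramePermutation                          -- ★ p851790: `g₃ g₄`, their frames and Grams (over ★ p851771 class ∕ κ facts, ★ p851724 `Q_b`)
import Literature.NumberTheory.Rogawski1990.FlickerRepresentativesTraceFrame                      -- ★ (P3c) LH4-p01 (g6): `exists_four_matched_trace_representatives`
import HarnessLib

/-!
# The type-(1) adapter and socket of T3′ IN THE TRACE FRAME: `Σᶠ_c Δ‴_v(γ_H, c)·Φ(c, f)` from four VALUES labelled by the 2-free literals `t₁^{(b)}, t_π^{(b)}`,
# and from their strata counts — no `e = ½`, no `x x̄ = 2`, no `y ȳ = −2`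
# (Rogawski 1990 §4.9 Prop. 4.9.1, §4.3 (4.3.1)–(4.3.2); Flicker 1998 Prop. 3, §6 Thm. 15)

Topic `NumberTheory/Rogawski1990`; namespace `Literature.NumberTheory.Rogawski1990`.  THEOREMS ONLY (no definition, no instance, no notation, no named fact, no `sorry`);
count-neutral; kernel lane `--supports stmt-HodgeConjecture-24833`.  Cell `pub/hodgecm-mathlib` (D-0151), crux H413 = `stmt-HodgeConjecture-24833`, half A line LH4 (dyadic pay-down;
(D-UNR) PRINT by ruling D74′), LEAD T13-42 price list (4), LH4-plan (g6) WORD #92 «(P3f) go (1)».  HONEST READER LABEL: ASSEMBLY over ★ material, asserts nothing printed; BANKED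
(the consumer — the G-side at a depth-zero piece, row #12 — is re-typed only after LAYER B lands its 2-free count heads); HC_CM is proved only modulo the 7 printed citations
(2 remaining named inputs: hLiu418 = stmt-HodgeConjecture-24832, h413 = stmt-HodgeConjecture-24833) until rung 0 closes; pays no organ, opens no road.

WHAT CHANGES AGAINST THE ★ ORIGINALS (★ `UnitFundamentalLemmaInertSplitClauseOfValuesStubFrame` :175 `…_of_split_of_values'`, ★ `DepthZeroKappaTransferTypeOneSocket` :50
`…_of_split_of_strata`): the scalar binders `{e π π' x y a d} (h2e : 2e = 1) (hσπ) (hππ) (hπN) (hx : x x̄ = 2) (hy : y ȳ = −2)` become `{b ε π π' a d} (hb : b + σb = 1) (hσπ) (hππ) (hπN)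
(hε : σε·ε = −1)` (★ p851783 `exists_traceFrame_scalars_of_nonsplit'` supplies them at every inert-unramified place, any residue characteristic); the four value labels `hΦ₁…hΦ₄`
name the TRACE literals `t₁^{(b)}(a,u,d)`, `t_π^{(b)}(a,u,d)`, `t_π^{(b)}(a,d,u)`, `t_π^{(b)}(u,a,d)` (★ p851724 (T3)(T5); classes 3∕4 are the `π`-literal with PERMUTED eigenvalues by
★ p851790 `g₃ g₄`, Flicker's trick); the representatives come from ★ (P3c) `exists_four_matched_trace_representatives` and the signs `(+,+,−,−)` from ★ p851771
`finKappaAt_trace_representatives_eq` (its Gram hypotheses `hG₃ hG₄` discharged by ★ p851790 `gThreeTrace_mul_traceFrame`∕`twistGram_traceFrameThree` etc.).  Everything else —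
HEAD 1 ★ `finsum_delta_mul_classOrbitalIntegral_eq_of_four_classes_of_values` (frame-generic), the exponent ★ `log_valued_eval_finCharpolyTwo_apply_eq_neg_add`, O8d-alg ★
`Flicker1998.depthZero_matrix_identity_rows` and the ℚ→ℂ casts — is VERBATIM and 2-free.  No `|2|` binder anywhere.

CONTENTS.
* §1 ADAPTER′ `finsum_finExplicitDelta_mul_classOrbitalIntegral_eq_of_split_of_values_trace'` — (F12) HEAD 3 ED.-2 shape in the trace frame: `Σᶠ_c Δ‴·Φ(c,f) = (−q)^{−(N₁+N₂)}·(X₁+X₂−X₃−X₄)`.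
* §2 SOCKET′ `finsum_finExplicitDelta_mul_classOrbitalIntegral_eq_of_split_of_strata_trace` — from strata-weighted values with the three κ-sums of a depth-zero piece to
  `M·(a₀′W(N−1) + a₁′w_N)`.

## References
* [Rogawski1990] J. D. Rogawski, *Automorphic Representations of Unitary Groups in Three Variables* (1990), §4.9 Prop. 4.9.1 (a)(b) p. 55; §4.3 (4.3.1)–(4.3.2) p. 43; §8.1 Prop. 8.1.1.
* [Flicker1998UnitaryFL] Y. Z. Flicker, *Elementary proof of the fundamental lemma for a unitary group*, Canad. J. Math. 50 (1998), Prop. 3 p. 78, §3 p. 80, §6 Thm. 15 p. 95.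
-/

set_option autoImplicit false

noncomputable section

open NumberField IsDedekindDomain Matrix Polynomial
open scoped MatrixGroups

namespace Literature.NumberTheory.Rogawski1990

open Literature.NumberTheory.Automorphic Literature.NumberTheory.Automorphic.UnitaryGroup
open Literature.NumberTheory.GaloisRepresentations Literature.NumberTheory.NumberFields Literature.NumberTheory.QuadraticForms

variable (L : Type) [Field L] [NumberField L] [IsCMField L] {v : HeightOneSpectrum (𝓞 ↥(maximalRealSubfield L))} (H' : Matrix (Fin 3) (Fin 3) L)

/-! ## §1 ADAPTER′ — (F12) HEAD 3 in the trace frame: the `G′`-side sum from four VALUES labelled by `t₁^{(b)}, t_π^{(b)}` -/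

section Adapter

set_option maxHeartbeats 400000 in
open scoped Classical in
/-- **(F12) HEAD 3 IN THE TRACE FRAME (ED.-2 shape: the value labels carry the level-preserving congruence `ψ`).**  In the frame of ★ `…_of_split_of_values'` (non-split unramified
`w ∣ v` of good reduction for `H′`, `μ` unramified at `w` under the N7 μ-guard, split eigen-data `α ≠ γ` of `χ_{g,w}` with `ord_w(α − u_w) = N₁`, `ord_w(γ − u_w) = N₂`), given the
2-FREE scalars `b + σb = 1`, `π` (`σ`-fixed non-norm, `ππ′ = 1`), `σε·ε = −1` (★ `exists_traceFrame_scalars_of_nonsplit'`) and an eigenframe `g P₂ = P₂ diag(a, d)` of `g` over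
`E_v` (norm-one `a ≠ d` off `u`), and FOUR VALUES `X₁ … X₄` attached to the trace literals `t₁^{(b)}(a,u,d)`, `t_π^{(b)}(a,u,d)`, `t_π^{(b)}(a,d,u)`, `t_π^{(b)}(u,a,d)` (★ p851724
(T3)(T5)) through ANY level-preserving congruence `(Tl, ψ)` («`Φ(⟦t⟧, f) = Xᵢ` whenever `ψ t` IS the `i`-th literal»), one has
`∑ᶠ c, Δ‴_v(γ_H, out c)·Φ(c, f) = (−q_v)^{−(N₁+N₂)}·(X₁ + X₂ − X₃ − X₄)` for every `f` and every orbital-measure family `mG`.  PROOF = ★ (P3c)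
`exists_four_matched_trace_representatives` ∘ ★ p851771 `finKappaAt_trace_representatives_eq` (`κ = (+,+,−,−)`, Grams by ★ p851790) ∘ ★ HEAD 1
`finsum_delta_mul_classOrbitalIntegral_eq_of_four_classes_of_values` ∘ ★ `log_valued_eval_finCharpolyTwo_apply_eq_neg_add`.  Twin of ★ `…_of_split_of_values'` with
`h2e hx hy` ELIMINATED. [cite: Flicker1998UnitaryFL, Prop. 3 p. 78; §6 p. 95] [cite: Rogawski1990, §4.3 (4.3.1)–(4.3.2) p. 43; §4.9 Prop. 4.9.1 (b) p. 55] -/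
theorem finsum_finExplicitDelta_mul_classOrbitalIntegral_eq_of_split_of_values_trace'
    (hH' : (H'.map (IsCMField.complexConj L))ᵀ = H') (w : PlacesOver L v)
    (hw : IsCMField.complexConj L • w.1 = w.1) (hv : Algebra.IsUnramifiedIn (𝓞 L) v.asIdeal)
    (hH'w : IsUnit (placeForm H' w.1)) (hH'i : hH'w.unit ∈ glInt 3 (w.1.adicCompletion L))
    (μ : HeckeCharacter L) (hμ : μ.IsUnramifiedAt w.1)
    [∀ γ : ((cmDatum L 3 H').Local v), MeasurableSpace (((cmDatum L 3 H').Local v) ⧸ Subgroup.centralizer ({γ} : Set ((cmDatum L 3 H').Local v)))]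
    (hl : ∀ (v : HeightOneSpectrum (𝓞 ↥(maximalRealSubfield L)))
      (a : (cmDatum L 2 (Matrix.of fun i j : Fin 2 => if i.val + j.val + 1 = 2 then (1 : L) else 0)).Local v ×
      (cmDatum L 1 (Matrix.of fun i j : Fin 1 => if i.val + j.val + 1 = 1 then (1 : L) else 0)).Local v)
      (b : (cmDatum L 3 H').Local v)
      (x : (cmDatum L 2 (Matrix.of fun i j : Fin 2 => if i.val + j.val + 1 = 2 then (1 : L) else 0)).Local v ×
      (cmDatum L 1 (Matrix.of fun i j : Fin 1 => if i.val + j.val + 1 = 1 then (1 : L) else 0)).Local v),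
      finExplicitDelta L v H' (x * a * x⁻¹) μ b = finExplicitDelta L v H' a μ b)
    (hr : ∀ (v : HeightOneSpectrum (𝓞 ↥(maximalRealSubfield L)))
      (a : (cmDatum L 2 (Matrix.of fun i j : Fin 2 => if i.val + j.val + 1 = 2 then (1 : L) else 0)).Local v ×
      (cmDatum L 1 (Matrix.of fun i j : Fin 1 => if i.val + j.val + 1 = 1 then (1 : L) else 0)).Local v)
      (b y : (cmDatum L 3 H').Local v),
      finExplicitDelta L v H' a μ (y * b * y⁻¹) = finExplicitDelta L v H' a μ b)
    (hH'u : IsUnit H')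
    (hμω : ∀ x : ideleGroup ↥(maximalRealSubfield L), μ (AdeleRing.ideleBaseChange ↥(maximalRealSubfield L) L x) = quadraticHeckeCharCM L x)
    {γH : ((cmDatum L 2 (Matrix.of fun i j : Fin 2 => if i.val + j.val + 1 = 2 then (1 : L) else 0)).Local v ×
      (cmDatum L 1 (Matrix.of fun i j : Fin 1 => if i.val + j.val + 1 = 1 then (1 : L) else 0)).Local v)}
    -- the split eigen-data of `stub_splitExponents`
    (α γ : w.1.adicCompletion L) (N₁ N₂ : ℕ)
    (hα : ((((γH.1.val : GL (Fin 2) (LocalRing L v)) : Matrix (Fin 2) (Fin 2) (LocalRing L v)).charpoly).map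
        (Pi.evalRingHom (fun w' : PlacesOver L v => w'.1.adicCompletion L) w)).IsRoot α)
    (hγ : ((((γH.1.val : GL (Fin 2) (LocalRing L v)) : Matrix (Fin 2) (Fin 2) (LocalRing L v)).charpoly).map
        (Pi.evalRingHom (fun w' : PlacesOver L v => w'.1.adicCompletion L) w)).IsRoot γ)
    (hαγ : α ≠ γ)
    (hN₁ : Valued.v (α - finGammaTwo L v γH w) = WithZero.exp (-(N₁ : ℤ)))
    (hN₂ : Valued.v (γ - finGammaTwo L v γH w) = WithZero.exp (-(N₂ : ℤ)))
    -- the 2-free scalars of the trace frame (★ `exists_traceFrame_scalars_of_nonsplit'`) and an eigenframe of `g` over `E_v` (★ (E1))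
    {b ε π π' a d : LocalRing L v} (hb : b + conjLocal L (IsCMField.complexConj L) v b = 1) (hσπ : conjLocal L (IsCMField.complexConj L) v π = π) (hππ : π * π' = 1)
    (hπN : ∀ z : LocalRing L v, conjLocal L (IsCMField.complexConj L) v z * z ≠ π)
    (hε : conjLocal L (IsCMField.complexConj L) v ε * ε = -1)
    (ha1 : conjLocal L (IsCMField.complexConj L) v a * a = 1) (hd1 : conjLocal L (IsCMField.complexConj L) v d * d = 1)
    {P₂ : GL (Fin 2) (LocalRing L v)} (hP₂ : (γH.1.val.val : Matrix (Fin 2) (Fin 2) (LocalRing L v)) * P₂.val = P₂.val * diagonal ![a, d])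
    (had : a ≠ d) (hab : a ≠ finGammaTwo L v γH) (hbd : finGammaTwo L v γH ≠ d)
    -- the test function, the family, and the four VALUES labelled by the trace literals
    (mG : OrbitalMeasureFamily ((cmDatum L 3 H').Local v)) (f : (cmDatum L 3 H').Local v → ℂ) {X₁ X₂ X₃ X₄ : ℂ}
    (hΦ₁ : ∀ (Tl : GL (Fin 3) (LocalRing L v)) (ψ : ↥(UnitaryGroup.«local» L (IsCMField.complexConj L) 3 H' v) ≃ₜ*
        ↥(UnitaryGroup.«local» L (IsCMField.complexConj L) 3 (Matrix.of fun i j : Fin 3 => if i.val + j.val + 1 = 3 then (1 : L) else 0) v))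
      (t : (cmDatum L 3 H').Local v),
      formCongr (conjLocal L (IsCMField.complexConj L) v) Tl (Matrix.of fun i j : Fin 3 => if i.val + j.val + 1 = 3 then (1 : LocalRing L v) else 0) =
          (adelicForm L 3 H').map (adeleToLocal L v) →
      (∀ g, (ψ g).val = Tl * g.val * Tl⁻¹) →
      (∀ g, g ∈ cmLocalIntegralLevel L 3 H' v ↔
        ψ g ∈ cmLocalIntegralLevel L 3 (Matrix.of fun i j : Fin 3 => if i.val + j.val + 1 = 3 then (1 : L) else 0) v) →
      (ψ t).val.val =
          !![a * conjLocal L (IsCMField.complexConj L) v b + d * b, 0, a - d; 0, finGammaTwo L v γH, 0; b * conjLocal L (IsCMField.complexConj L) v b * (a - d), 0, a * b + d * conjLocal L (IsCMField.complexConj L) v b] →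
      classOrbitalIntegral mG f (ConjClasses.mk t) = X₁)
    (hΦ₂ : ∀ (Tl : GL (Fin 3) (LocalRing L v)) (ψ : ↥(UnitaryGroup.«local» L (IsCMField.complexConj L) 3 H' v) ≃ₜ*
        ↥(UnitaryGroup.«local» L (IsCMField.complexConj L) 3 (Matrix.of fun i j : Fin 3 => if i.val + j.val + 1 = 3 then (1 : L) else 0) v))
      (t : (cmDatum L 3 H').Local v),
      formCongr (conjLocal L (IsCMField.complexConj L) v) Tl (Matrix.of fun i j : Fin 3 => if i.val + j.val + 1 = 3 then (1 : LocalRing L v) else 0) =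
          (adelicForm L 3 H').map (adeleToLocal L v) →
      (∀ g, (ψ g).val = Tl * g.val * Tl⁻¹) →
      (∀ g, g ∈ cmLocalIntegralLevel L 3 H' v ↔
        ψ g ∈ cmLocalIntegralLevel L 3 (Matrix.of fun i j : Fin 3 => if i.val + j.val + 1 = 3 then (1 : L) else 0) v) →
      (ψ t).val.val =
          !![a * conjLocal L (IsCMField.complexConj L) v b + d * b, 0, π * (a - d); 0, finGammaTwo L v γH, 0; π' * (b * conjLocal L (IsCMField.complexConj L) v b * (a - d)), 0, a * b + d * conjLocal L (IsCMField.complexConj L) v b] →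
      classOrbitalIntegral mG f (ConjClasses.mk t) = X₂)
    (hΦ₃ : ∀ (Tl : GL (Fin 3) (LocalRing L v)) (ψ : ↥(UnitaryGroup.«local» L (IsCMField.complexConj L) 3 H' v) ≃ₜ*
        ↥(UnitaryGroup.«local» L (IsCMField.complexConj L) 3 (Matrix.of fun i j : Fin 3 => if i.val + j.val + 1 = 3 then (1 : L) else 0) v))
      (t : (cmDatum L 3 H').Local v),
      formCongr (conjLocal L (IsCMField.complexConj L) v) Tl (Matrix.of fun i j : Fin 3 => if i.val + j.val + 1 = 3 then (1 : LocalRing L v) else 0) =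
          (adelicForm L 3 H').map (adeleToLocal L v) →
      (∀ g, (ψ g).val = Tl * g.val * Tl⁻¹) →
      (∀ g, g ∈ cmLocalIntegralLevel L 3 H' v ↔
        ψ g ∈ cmLocalIntegralLevel L 3 (Matrix.of fun i j : Fin 3 => if i.val + j.val + 1 = 3 then (1 : L) else 0) v) →
      (ψ t).val.val =
          !![a * conjLocal L (IsCMField.complexConj L) v b + finGammaTwo L v γH * b, 0, π * (a - finGammaTwo L v γH); 0, d, 0; π' * (b * conjLocal L (IsCMField.complexConj L) v b * (a - finGammaTwo L v γH)), 0, a * b + finGammaTwo L v γH * conjLocal L (IsCMField.complexConj L) v b] →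
      classOrbitalIntegral mG f (ConjClasses.mk t) = X₃)
    (hΦ₄ : ∀ (Tl : GL (Fin 3) (LocalRing L v)) (ψ : ↥(UnitaryGroup.«local» L (IsCMField.complexConj L) 3 H' v) ≃ₜ*
        ↥(UnitaryGroup.«local» L (IsCMField.complexConj L) 3 (Matrix.of fun i j : Fin 3 => if i.val + j.val + 1 = 3 then (1 : L) else 0) v))
      (t : (cmDatum L 3 H').Local v),
      formCongr (conjLocal L (IsCMField.complexConj L) v) Tl (Matrix.of fun i j : Fin 3 => if i.val + j.val + 1 = 3 then (1 : LocalRing L v) else 0) =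
          (adelicForm L 3 H').map (adeleToLocal L v) →
      (∀ g, (ψ g).val = Tl * g.val * Tl⁻¹) →
      (∀ g, g ∈ cmLocalIntegralLevel L 3 H' v ↔
        ψ g ∈ cmLocalIntegralLevel L 3 (Matrix.of fun i j : Fin 3 => if i.val + j.val + 1 = 3 then (1 : L) else 0) v) →
      (ψ t).val.val =
          !![finGammaTwo L v γH * conjLocal L (IsCMField.complexConj L) v b + d * b, 0, π * (finGammaTwo L v γH - d); 0, a, 0; π' * (b * conjLocal L (IsCMField.complexConj L) v b * (finGammaTwo L v γH - d)), 0, finGammaTwo L v γH * b + d * conjLocal L (IsCMField.complexConj L) v b] →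
      classOrbitalIntegral mG f (ConjClasses.mk t) = X₄) :
    ∑ᶠ c : ConjClasses ((cmDatum L 3 H').Local v),
        (finExplicitCollection L H' μ hl hr v).Δ γH (Quotient.out c) * classOrbitalIntegral mG f c =
      (-((Ideal.absNorm v.asIdeal : ℂ))) ^ (-((N₁ : ℤ) + N₂)) * (X₁ + X₂ - X₃ - X₄) := by
  have hvs : Subsingleton (PlacesOver L v) :=
    PlacesOver.subsingleton_of_smul_eq (IsCMField.complexConj L) (IsCMField.complexConj_ne_one L) w hw
  have hσσ : ∀ x, conjLocal L (IsCMField.complexConj L) v (conjLocal L (IsCMField.complexConj L) v x) = x := by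
    obtain ⟨ζ, hζ⟩ := not_forall.1 fun h0 => IsCMField.complexConj_ne_one L (AlgEquiv.ext h0)
    have hcδ : IsCMField.complexConj L (ζ - IsCMField.complexConj L ζ) = -(ζ - IsCMField.complexConj L ζ) := by
      rw [map_sub, IsCMField.complexConj_apply_apply, neg_sub]
    have hδ : ζ - IsCMField.complexConj L ζ ≠ 0 := fun h0 => hζ (by rw [sub_eq_zero] at h0; exact h0.symm)
    exact Liu2021.LemD1OfPlace.conjLocal_conjLocal_apply L v (IsCMField.complexConj L) hcδ hδ
  -- (1) the roots read in `LocalRing L v`-currency, `χ_g(u)` a unit, and the exponent `log |χ_g(u)|_w = −(N₁+N₂)`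
  have hα' : ((finCharpolyTwo L v γH).map (Pi.evalRingHom (fun w' : PlacesOver L v => w'.1.adicCompletion L) w)).IsRoot α := hα
  have hγ' : ((finCharpolyTwo L v γH).map (Pi.evalRingHom (fun w' : PlacesOver L v => w'.1.adicCompletion L) w)).IsRoot γ := hγ
  have hαb : α ≠ finGammaTwo L v γH w := fun h0 => by
    rw [h0, sub_self, map_zero] at hN₁; exact WithZero.zero_ne_coe hN₁
  have hγb : γ ≠ finGammaTwo L v γH w := fun h0 => by
    rw [h0, sub_self, map_zero] at hN₂; exact WithZero.zero_ne_coe hN₂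
  have hu : IsUnit ((finCharpolyTwo L v γH).eval (finGammaTwo L v γH)) := isUnit_eval_finCharpolyTwo_of_isRoot L v w γH hvs hα' hγ' hαγ hαb hγb
  have hlog := log_valued_eval_finCharpolyTwo_apply_eq_neg_add L v w γH hα' hγ' hαγ hN₁ hN₂
  -- (2) the local hermitian data of `H′`
  have hH'c : (H'.map (cmConjRingHom L))ᵀ = H' := by
    have e1 : H'.map (cmConjRingHom L) = H'.map (IsCMField.complexConj L) := by
      ext i j; simp [Matrix.map_apply, cmConjRingHom_apply]
    rw [e1]; exact hH'
  have hH := map_conjLocal_transpose_localForm L 3 H' v hH'c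
  have hHd := isUnit_det_localForm L 3 H' v (Matrix.isUnit_iff_isUnit_det _ |>.1 hH'u).ne_zero
  -- (3) the four matched representatives in the trace frame (★ (P3c))
  obtain ⟨Tl, ψ, t₁, t₂, t₃, t₄, τ₁, τ₂, τ₃, τ₄, P, Q, dπ, g₃, g₄, hform, hψ, -, hlev, h₁, h₂, h₃, h₄, hP, hu', hu'1, hPQ, hQ,
    hψ₁, hψ₂, hψ₃, hψ₄, hτ₁, hτ₂c, hτ₃c, hτ₄c, hdπ, hg₃, hg₄, hτ₂, hτ₃, hτ₄, n12, n34⟩ :=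
    exists_four_matched_trace_representatives L H' hH' w hw hv hH'w hH'i (γH := γH) hb hσπ hππ hπN hε ha1 hd1 hP₂ had hab hbd
  -- images: `Tl tᵢ Tl⁻¹ = (ψ tᵢ) = τᵢ`
  have himg : ∀ {t : (cmDatum L 3 H').Local v} {τ : ↥(UnitaryGroup.«local» L (IsCMField.complexConj L) 3
      (Matrix.of fun i j : Fin 3 => if i.val + j.val + 1 = 3 then (1 : L) else 0) v)}, ψ t = τ → Tl * t.val * Tl⁻¹ = τ.val := by
    intro t τ h
    rw [← hψ t, h]
  -- (4) the Grams of the conjugators' frames (★ p851790) and the signs (★ p851771)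
  have hG₃ : twistGram (conjLocal L (IsCMField.complexConj L) v) (Matrix.of fun i j : Fin 3 => if i.val + j.val + 1 = 3 then (1 : LocalRing L v) else 0) (g₃.val * Q.val) = !![π, 0, 0; 0, -π, 0; 0, 0, -1] := by
    rw [hg₃, hQ, gThreeTrace_mul_traceFrame (conjLocal L (IsCMField.complexConj L) v) hb, twistGram_traceFrameThree (conjLocal L (IsCMField.complexConj L) v) hσσ hb hσπ hε]
  have hG₄ : twistGram (conjLocal L (IsCMField.complexConj L) v) (Matrix.of fun i j : Fin 3 => if i.val + j.val + 1 = 3 then (1 : LocalRing L v) else 0) (g₄.val * Q.val) = !![1, 0, 0; 0, π, 0; 0, 0, -π] := by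
    rw [hg₄, hQ, gFourTrace_mul_traceFrame (conjLocal L (IsCMField.complexConj L) v) hb, twistGram_traceFrameFour (conjLocal L (IsCMField.complexConj L) v) hσσ hb hσπ]
  obtain ⟨hκ₁, hκ₂, hκ₃, hκ₄⟩ := finKappaAt_trace_representatives_eq L v H' γH w hw hu hH hHd hb hε hσπ hπN hform h₁ h₃ h₄ hP hu' hu'1 hPQ hQ
    hdπ hG₃ hG₄ (by rw [himg hψ₂, himg hψ₁, hτ₂c]) (by rw [himg hψ₃, himg hψ₁, hτ₃c]) (by rw [himg hψ₄, himg hψ₁, hτ₄c])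
  -- (5) the values at the four classes
  have hX₁ : classOrbitalIntegral mG f (ConjClasses.mk t₁) = X₁ := hΦ₁ Tl ψ t₁ hform hψ hlev (by rw [hψ₁, hτ₁])
  have hX₂ : classOrbitalIntegral mG f (ConjClasses.mk t₂) = X₂ := hΦ₂ Tl ψ t₂ hform hψ hlev (by rw [hψ₂, hτ₂])
  have hX₃ : classOrbitalIntegral mG f (ConjClasses.mk t₃) = X₃ := hΦ₃ Tl ψ t₃ hform hψ hlev (by rw [hψ₃, hτ₃])
  have hX₄ : classOrbitalIntegral mG f (ConjClasses.mk t₄) = X₄ := hΦ₄ Tl ψ t₄ hform hψ hlev (by rw [hψ₄, hτ₄])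
  -- (6) HEAD 1 and the exponent
  rw [finsum_delta_mul_classOrbitalIntegral_eq_of_four_classes_of_values L v H' γH w hw μ hμω hv hμ hl hr h₁ h₂ h₃ h₄ hu hH hHd hP hu' hu'1 n12 n34
    hκ₁ hκ₂ hκ₃ hκ₄ mG f hX₁ hX₂ hX₃ hX₄, hlog]

end Adapter

/-! ## §2 SOCKET′ — from the strata counts of the four trace literals to `Σᶠ_c Δ‴_v(γ_H, c)·Φ(c, g) = M·(a₀′ W(N−1) + a₁′ w_N)` -/

section Socket

set_option maxHeartbeats 400000 in
open scoped Classical in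
/-- **THE TYPE-(1) SOCKET OF T3′ IN THE TRACE FRAME**: in the frame of §1, suppose the four literal VALUES of `f` are `X_i = M·(c₀ n_{i,0} + c₁ n_{i,1} + c₂ n_{i,2})` (the shape ★ O8b
produces for a depth-zero piece) and the three κ-SUMS (`κ = (+,+,−,−)`) of the counts `n i r` are the unit value `(−q)^{N₁+N₂} W(N)`, the level-one value `(−q)^{N₁+N₂−2} W(N−1)`
and the free count `(−1)^{N₁+N₂}(q+1)² q^{N₁+N₂+N−2}`.  Then `Σᶠ_c Δ‴_v(γ_H, c)·Φ(c, f) = M·((q⁻²c₀ + ((q²−1)∕q²)c₁)·W(N−1) + (−q⁻¹c₁ + ((q+1)∕q)c₂)·(W(N) − W(N−1)))`.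
PROOF = §1 + the three rows of ★ `Flicker1998.depthZero_matrix_identity_rows` cast to `ℂ` (verbatim).  Twin of ★ `…_eq_of_split_of_strata` with `h2e hx hy` ELIMINATED (labels on
`t₁^{(b)}, t_π^{(b)}`). [cite: Rogawski1990, §4.9 Prop. 4.9.1 (a) p. 55; §4.3 (4.3.1)–(4.3.2) p. 43] [cite: Flicker1998UnitaryFL, Prop. 3 p. 78; §6 Thm. 15 p. 95] -/
theorem finsum_finExplicitDelta_mul_classOrbitalIntegral_eq_of_split_of_strata_trace
    (hH' : (H'.map (IsCMField.complexConj L))ᵀ = H') (w : PlacesOver L v)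
    (hw : IsCMField.complexConj L • w.1 = w.1) (hv : Algebra.IsUnramifiedIn (𝓞 L) v.asIdeal)
    (hH'w : IsUnit (placeForm H' w.1)) (hH'i : hH'w.unit ∈ glInt 3 (w.1.adicCompletion L))
    (μ : HeckeCharacter L) (hμ : μ.IsUnramifiedAt w.1)
    [∀ γ : ((cmDatum L 3 H').Local v), MeasurableSpace (((cmDatum L 3 H').Local v) ⧸ Subgroup.centralizer ({γ} : Set ((cmDatum L 3 H').Local v)))]
    (hl : ∀ (v : HeightOneSpectrum (𝓞 ↥(maximalRealSubfield L)))
      (a : (cmDatum L 2 (Matrix.of fun i j : Fin 2 => if i.val + j.val + 1 = 2 then (1 : L) else 0)).Local v ×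
      (cmDatum L 1 (Matrix.of fun i j : Fin 1 => if i.val + j.val + 1 = 1 then (1 : L) else 0)).Local v)
      (b : (cmDatum L 3 H').Local v)
      (x : (cmDatum L 2 (Matrix.of fun i j : Fin 2 => if i.val + j.val + 1 = 2 then (1 : L) else 0)).Local v ×
      (cmDatum L 1 (Matrix.of fun i j : Fin 1 => if i.val + j.val + 1 = 1 then (1 : L) else 0)).Local v),
      finExplicitDelta L v H' (x * a * x⁻¹) μ b = finExplicitDelta L v H' a μ b)
    (hr : ∀ (v : HeightOneSpectrum (𝓞 ↥(maximalRealSubfield L)))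
      (a : (cmDatum L 2 (Matrix.of fun i j : Fin 2 => if i.val + j.val + 1 = 2 then (1 : L) else 0)).Local v ×
      (cmDatum L 1 (Matrix.of fun i j : Fin 1 => if i.val + j.val + 1 = 1 then (1 : L) else 0)).Local v)
      (b y : (cmDatum L 3 H').Local v),
      finExplicitDelta L v H' a μ (y * b * y⁻¹) = finExplicitDelta L v H' a μ b)
    (hH'u : IsUnit H')
    (hμω : ∀ x : ideleGroup ↥(maximalRealSubfield L), μ (AdeleRing.ideleBaseChange ↥(maximalRealSubfield L) L x) = quadraticHeckeCharCM L x)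
    {γH : ((cmDatum L 2 (Matrix.of fun i j : Fin 2 => if i.val + j.val + 1 = 2 then (1 : L) else 0)).Local v ×
      (cmDatum L 1 (Matrix.of fun i j : Fin 1 => if i.val + j.val + 1 = 1 then (1 : L) else 0)).Local v)}
    -- the split eigen-data of `stub_splitExponents`
    (α γ : w.1.adicCompletion L) (N₁ N₂ : ℕ)
    (hα : ((((γH.1.val : GL (Fin 2) (LocalRing L v)) : Matrix (Fin 2) (Fin 2) (LocalRing L v)).charpoly).map
        (Pi.evalRingHom (fun w' : PlacesOver L v => w'.1.adicCompletion L) w)).IsRoot α)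
    (hγ : ((((γH.1.val : GL (Fin 2) (LocalRing L v)) : Matrix (Fin 2) (Fin 2) (LocalRing L v)).charpoly).map
        (Pi.evalRingHom (fun w' : PlacesOver L v => w'.1.adicCompletion L) w)).IsRoot γ)
    (hαγ : α ≠ γ)
    (hN₁ : Valued.v (α - finGammaTwo L v γH w) = WithZero.exp (-(N₁ : ℤ)))
    (hN₂ : Valued.v (γ - finGammaTwo L v γH w) = WithZero.exp (-(N₂ : ℤ)))
    -- the 2-free scalars of the trace frame (★ `exists_traceFrame_scalars_of_nonsplit'`) and an eigenframe of `g` over `E_v` (★ (E1))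
    {b ε π π' a d : LocalRing L v} (hb : b + conjLocal L (IsCMField.complexConj L) v b = 1) (hσπ : conjLocal L (IsCMField.complexConj L) v π = π) (hππ : π * π' = 1)
    (hπN : ∀ z : LocalRing L v, conjLocal L (IsCMField.complexConj L) v z * z ≠ π)
    (hε : conjLocal L (IsCMField.complexConj L) v ε * ε = -1)
    (ha1 : conjLocal L (IsCMField.complexConj L) v a * a = 1) (hd1 : conjLocal L (IsCMField.complexConj L) v d * d = 1)
    {P₂ : GL (Fin 2) (LocalRing L v)} (hP₂ : (γH.1.val.val : Matrix (Fin 2) (Fin 2) (LocalRing L v)) * P₂.val = P₂.val * diagonal ![a, d])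
    (had : a ≠ d) (hab : a ≠ finGammaTwo L v γH) (hbd : finGammaTwo L v γH ≠ d)
    -- the test function, the family, and the four VALUES labelled by the trace literals
    (mG : OrbitalMeasureFamily ((cmDatum L 3 H').Local v)) (f : (cmDatum L 3 H').Local v → ℂ)
    -- the H-depth, deepness, the piece's stratum values `c`, the mass `M = ν_G(K)`, and the STRATA COUNTS `n i r` of the four literals with their three κ-sums
    (N : ℕ) (hN : 1 ≤ N) (h₁ : 1 ≤ N₁) (h₂ : 1 ≤ N₂) (hq : 1 < Ideal.absNorm v.asIdeal) (M : ℂ) (c : ℕ → ℂ) (n : Fin 4 → ℕ → ℕ)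
    (hK : ((n 0 0 + n 0 1 + n 0 2 + (n 1 0 + n 1 1 + n 1 2) : ℕ) : ℚ) - ((n 2 0 + n 2 1 + n 2 2 + (n 3 0 + n 3 1 + n 3 2) : ℕ) : ℚ) =
      (-(Ideal.absNorm v.asIdeal : ℚ)) ^ (N₁ + N₂) * Flicker1998.phiH (Ideal.absNorm v.asIdeal) N)
    (hK₀ : ((n 0 0 + n 1 0 : ℕ) : ℚ) - ((n 2 0 + n 3 0 : ℕ) : ℚ) = (-(Ideal.absNorm v.asIdeal : ℚ)) ^ (N₁ + N₂ - 2) * Flicker1998.phiH (Ideal.absNorm v.asIdeal) (N - 1))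
    (hK₂ : ((n 0 2 + n 1 2 : ℕ) : ℚ) - ((n 2 2 + n 3 2 : ℕ) : ℚ) =
      (-1 : ℚ) ^ (N₁ + N₂) * ((Ideal.absNorm v.asIdeal : ℚ) + 1) ^ 2 * (Ideal.absNorm v.asIdeal : ℚ) ^ (N₁ + N₂ + N - 2))
    (hΦ₁ : ∀ (Tl : GL (Fin 3) (LocalRing L v)) (ψ : ↥(UnitaryGroup.«local» L (IsCMField.complexConj L) 3 H' v) ≃ₜ*
        ↥(UnitaryGroup.«local» L (IsCMField.complexConj L) 3 (Matrix.of fun i j : Fin 3 => if i.val + j.val + 1 = 3 then (1 : L) else 0) v))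
      (t : (cmDatum L 3 H').Local v),
      formCongr (conjLocal L (IsCMField.complexConj L) v) Tl (Matrix.of fun i j : Fin 3 => if i.val + j.val + 1 = 3 then (1 : LocalRing L v) else 0) =
          (adelicForm L 3 H').map (adeleToLocal L v) →
      (∀ g, (ψ g).val = Tl * g.val * Tl⁻¹) →
      (∀ g, g ∈ cmLocalIntegralLevel L 3 H' v ↔
        ψ g ∈ cmLocalIntegralLevel L 3 (Matrix.of fun i j : Fin 3 => if i.val + j.val + 1 = 3 then (1 : L) else 0) v) →
      (ψ t).val.val =
          !![a * conjLocal L (IsCMField.complexConj L) v b + d * b, 0, a - d; 0, finGammaTwo L v γH, 0; b * conjLocal L (IsCMField.complexConj L) v b * (a - d), 0, a * b + d * conjLocal L (IsCMField.complexConj L) v b] →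
      classOrbitalIntegral mG f (ConjClasses.mk t) = M * (c 0 * (n 0 0 : ℂ) + c 1 * (n 0 1 : ℂ) + c 2 * (n 0 2 : ℂ)))
    (hΦ₂ : ∀ (Tl : GL (Fin 3) (LocalRing L v)) (ψ : ↥(UnitaryGroup.«local» L (IsCMField.complexConj L) 3 H' v) ≃ₜ*
        ↥(UnitaryGroup.«local» L (IsCMField.complexConj L) 3 (Matrix.of fun i j : Fin 3 => if i.val + j.val + 1 = 3 then (1 : L) else 0) v))
      (t : (cmDatum L 3 H').Local v),
      formCongr (conjLocal L (IsCMField.complexConj L) v) Tl (Matrix.of fun i j : Fin 3 => if i.val + j.val + 1 = 3 then (1 : LocalRing L v) else 0) =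
          (adelicForm L 3 H').map (adeleToLocal L v) →
      (∀ g, (ψ g).val = Tl * g.val * Tl⁻¹) →
      (∀ g, g ∈ cmLocalIntegralLevel L 3 H' v ↔
        ψ g ∈ cmLocalIntegralLevel L 3 (Matrix.of fun i j : Fin 3 => if i.val + j.val + 1 = 3 then (1 : L) else 0) v) →
      (ψ t).val.val =
          !![a * conjLocal L (IsCMField.complexConj L) v b + d * b, 0, π * (a - d); 0, finGammaTwo L v γH, 0; π' * (b * conjLocal L (IsCMField.complexConj L) v b * (a - d)), 0, a * b + d * conjLocal L (IsCMField.complexConj L) v b] →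
      classOrbitalIntegral mG f (ConjClasses.mk t) = M * (c 0 * (n 1 0 : ℂ) + c 1 * (n 1 1 : ℂ) + c 2 * (n 1 2 : ℂ)))
    (hΦ₃ : ∀ (Tl : GL (Fin 3) (LocalRing L v)) (ψ : ↥(UnitaryGroup.«local» L (IsCMField.complexConj L) 3 H' v) ≃ₜ*
        ↥(UnitaryGroup.«local» L (IsCMField.complexConj L) 3 (Matrix.of fun i j : Fin 3 => if i.val + j.val + 1 = 3 then (1 : L) else 0) v))
      (t : (cmDatum L 3 H').Local v),
      formCongr (conjLocal L (IsCMField.complexConj L) v) Tl (Matrix.of fun i j : Fin 3 => if i.val + j.val + 1 = 3 then (1 : LocalRing L v) else 0) =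
          (adelicForm L 3 H').map (adeleToLocal L v) →
      (∀ g, (ψ g).val = Tl * g.val * Tl⁻¹) →
      (∀ g, g ∈ cmLocalIntegralLevel L 3 H' v ↔
        ψ g ∈ cmLocalIntegralLevel L 3 (Matrix.of fun i j : Fin 3 => if i.val + j.val + 1 = 3 then (1 : L) else 0) v) →
      (ψ t).val.val =
          !![a * conjLocal L (IsCMField.complexConj L) v b + finGammaTwo L v γH * b, 0, π * (a - finGammaTwo L v γH); 0, d, 0; π' * (b * conjLocal L (IsCMField.complexConj L) v b * (a - finGammaTwo L v γH)), 0, a * b + finGammaTwo L v γH * conjLocal L (IsCMField.complexConj L) v b] →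
      classOrbitalIntegral mG f (ConjClasses.mk t) = M * (c 0 * (n 2 0 : ℂ) + c 1 * (n 2 1 : ℂ) + c 2 * (n 2 2 : ℂ)))
    (hΦ₄ : ∀ (Tl : GL (Fin 3) (LocalRing L v)) (ψ : ↥(UnitaryGroup.«local» L (IsCMField.complexConj L) 3 H' v) ≃ₜ*
        ↥(UnitaryGroup.«local» L (IsCMField.complexConj L) 3 (Matrix.of fun i j : Fin 3 => if i.val + j.val + 1 = 3 then (1 : L) else 0) v))
      (t : (cmDatum L 3 H').Local v),
      formCongr (conjLocal L (IsCMField.complexConj L) v) Tl (Matrix.of fun i j : Fin 3 => if i.val + j.val + 1 = 3 then (1 : LocalRing L v) else 0) =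
          (adelicForm L 3 H').map (adeleToLocal L v) →
      (∀ g, (ψ g).val = Tl * g.val * Tl⁻¹) →
      (∀ g, g ∈ cmLocalIntegralLevel L 3 H' v ↔
        ψ g ∈ cmLocalIntegralLevel L 3 (Matrix.of fun i j : Fin 3 => if i.val + j.val + 1 = 3 then (1 : L) else 0) v) →
      (ψ t).val.val =
          !![finGammaTwo L v γH * conjLocal L (IsCMField.complexConj L) v b + d * b, 0, π * (finGammaTwo L v γH - d); 0, a, 0; π' * (b * conjLocal L (IsCMField.complexConj L) v b * (finGammaTwo L v γH - d)), 0, finGammaTwo L v γH * b + d * conjLocal L (IsCMField.complexConj L) v b] →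
      classOrbitalIntegral mG f (ConjClasses.mk t) = M * (c 0 * (n 3 0 : ℂ) + c 1 * (n 3 1 : ℂ) + c 2 * (n 3 2 : ℂ))) :
    ∑ᶠ c : ConjClasses ((cmDatum L 3 H').Local v),
        (finExplicitCollection L H' μ hl hr v).Δ γH (Quotient.out c) * classOrbitalIntegral mG f c =
      M * (((((Ideal.absNorm v.asIdeal : ℂ)) ^ 2)⁻¹ * c 0 + ((((Ideal.absNorm v.asIdeal : ℂ)) ^ 2 - 1) / ((Ideal.absNorm v.asIdeal : ℂ)) ^ 2) * c 1) *
          ((Flicker1998.phiH (Ideal.absNorm v.asIdeal) (N - 1) : ℚ) : ℂ) +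
        (-((Ideal.absNorm v.asIdeal : ℂ))⁻¹ * c 1 + ((((Ideal.absNorm v.asIdeal : ℂ)) + 1) / ((Ideal.absNorm v.asIdeal : ℂ))) * c 2) *
          ((Flicker1998.phiH (Ideal.absNorm v.asIdeal) N - Flicker1998.phiH (Ideal.absNorm v.asIdeal) (N - 1) : ℚ) : ℂ)) := by
  -- §1 with the four values `X_i := M · Σ_r c_r n_{i,r}`
  rw [finsum_finExplicitDelta_mul_classOrbitalIntegral_eq_of_split_of_values_trace' L H' hH' w hw hv hH'w hH'i μ hμ hl hr hH'u hμω α γ N₁ N₂ hα hγ hαγ hN₁ hN₂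
    hb hσπ hππ hπN hε ha1 hd1 hP₂ had hab hbd mG f hΦ₁ hΦ₂ hΦ₃ hΦ₄]
  -- the three rows of the matrix identity (★ O8d-alg), cast to `ℂ`
  obtain ⟨r0, r1, r2⟩ := Flicker1998.depthZero_matrix_identity_rows hq h₁ h₂ hN hK hK₀ hK₂
  have hz : (-(Ideal.absNorm v.asIdeal : ℂ)) ^ (-((N₁ : ℤ) + N₂)) = ((-(Ideal.absNorm v.asIdeal : ℂ)) ^ (N₁ + N₂))⁻¹ := by
    rw [← Nat.cast_add, _root_.zpow_neg, zpow_natCast]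
  have r0' := congrArg (fun x : ℚ => (x : ℂ)) r0
  have r1' := congrArg (fun x : ℚ => (x : ℂ)) r1
  have r2' := congrArg (fun x : ℚ => (x : ℂ)) r2
  push_cast at r0' r1' r2'
  rw [hz]
  push_cast
  linear_combination M * (c 0 * r0' + c 1 * r1' + c 2 * r2')

end Socket

end Literature.NumberTheory.Rogawski1990

end
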